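import Summits.Ventures.QEC.CircuitDistance.ETowerKZ
import HarnessLib

/-!
# E-fold tower ([[144,12,12]], W = 9, node K) — sector Z, WINDOW cubes (3, 0) … (3, 7)

STEP 2 of R152 (2) (CARD-7; STEP2-ASSEMBLY-SPEC §B7). Each theorem certifies one scan WINDOW (`W3WIN3`) of the level-C fibre over one of the
4 low-weight `(6,6)` words `W3L` by `decide +kernel` (`nodeCW`; idea-1: ≈ 27 s each). No `native_decide`. Emitted by qec-cdx-eng-1 g2.
-/

set_option maxRecDepth 100000

namespace Summit.Ventures.QEC.CircuitDistance.ETower.SecZ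

set_option maxHeartbeats 400000000 in
/-- WINDOW FACT (§B7): the level-C fibre of `W3L[3]`, scan window `W3WIN3[0]`, passes. -/
theorem winZ_3_0 : nodeCW (W3L.getD 3 []) (W3WIN3.getD 0 (0,0)) = true := by decide +kernel

set_option maxHeartbeats 400000000 in
/-- WINDOW FACT (§B7): the level-C fibre of `W3L[3]`, scan window `W3WIN3[1]`, passes. -/
theorem winZ_3_1 : nodeCW (W3L.getD 3 []) (W3WIN3.getD 1 (0,0)) = true := by decide +kernel

set_option maxHeartbeats 400000000 in
/-- WINDOW FACT (§B7): the level-C fibre of `W3L[3]`, scan window `W3WIN3[2]`, passes. -/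
theorem winZ_3_2 : nodeCW (W3L.getD 3 []) (W3WIN3.getD 2 (0,0)) = true := by decide +kernel

set_option maxHeartbeats 400000000 in
/-- WINDOW FACT (§B7): the level-C fibre of `W3L[3]`, scan window `W3WIN3[3]`, passes. -/
theorem winZ_3_3 : nodeCW (W3L.getD 3 []) (W3WIN3.getD 3 (0,0)) = true := by decide +kernel

set_option maxHeartbeats 400000000 in
/-- WINDOW FACT (§B7): the level-C fibre of `W3L[3]`, scan window `W3WIN3[4]`, passes. -/
theorem winZ_3_4 : nodeCW (W3L.getD 3 []) (W3WIN3.getD 4 (0,0)) = true := by decide +kernel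

set_option maxHeartbeats 400000000 in
/-- WINDOW FACT (§B7): the level-C fibre of `W3L[3]`, scan window `W3WIN3[5]`, passes. -/
theorem winZ_3_5 : nodeCW (W3L.getD 3 []) (W3WIN3.getD 5 (0,0)) = true := by decide +kernel

set_option maxHeartbeats 400000000 in
/-- WINDOW FACT (§B7): the level-C fibre of `W3L[3]`, scan window `W3WIN3[6]`, passes. -/
theorem winZ_3_6 : nodeCW (W3L.getD 3 []) (W3WIN3.getD 6 (0,0)) = true := by decide +kernel

set_option maxHeartbeats 400000000 in
/-- WINDOW FACT (§B7): the level-C fibre of `W3L[3]`, scan window `W3WIN3[7]`, passes. -/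
theorem winZ_3_7 : nodeCW (W3L.getD 3 []) (W3WIN3.getD 7 (0,0)) = true := by decide +kernel

end Summit.Ventures.QEC.CircuitDistance.ETower.SecZ
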